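/-
Copyright: the m5 harness (cell B2b-5 `b2b-lgcu-borel`, generation 22).  Sorry-free; axioms: propext,
Classical.choice, Quot.sound.  VALUE = THEOREM (a budget-free, TPP-free configuration exclusion on the
level-one slice), NOT summit progress: the crux `SubgroupIdentityDesigns`
(stmt-MatrixMultiplication-14079) is untouched and remains open.
-/
import Mathlib
import Literature.NumberTheory.EllipticCurves.BinaryQuarticDiscriminantFpCountProofs
import Literature.NumberTheory.EllipticCurves.HalfIntegralWeightFormsGaussSumProofs
import Summits.MatrixMultiplication.MatrixMultiplication.Theorems.SubgroupIdentityDesigns.Negative.DihedralUnipotent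
import Summits.MatrixMultiplication.MatrixMultiplication.Theorems.SubgroupIdentityDesigns.Negative.NonsquareReflections

/-!
# Non-square reflections of four coordinates lie in no member — every odd `p`, every `m ≥ 4`

Route `LevelGradedCohnUmans`, crux `SubgroupIdentityDesigns`, level-one slice, `m ≥ 4`.

Companion of `NonsquareReflections` (which treats three coordinates and needs `p ≡ 3 (mod 4)`).
In dimension `4` the restriction disappears:

**COVER LEMMA** (`exists_orth_nonsquare4`, every odd `p`, every `u ∈ 𝔽_p⁴`, zero or not): some
`b ⊥ u` has `Q(b) = b ⬝ b` a non-square.  If `−1` is a non-square this is the three-coordinate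
lemma (`b = (b', 0)`, or `b = (x, y, 0, 0)` with `x² + y² = −1` when `u` vanishes on the first three
coordinates).  If `−1 = i²`, pass to HYPERBOLIC COORDINATES: `b = (x + y, i(x − y), z + t, i(z − t))`
has `Q(b) = 4(xy + zt)` and `b ⬝ u = αx + βy + γz + δt` with `α, β = u₀ ± i u₁`, `γ, δ = u₂ ± i u₃`;
take `(z,t) = (1, n/4)` and solve the linear equation for `x` (if `α ≠ 0`, `y = 0`) or `y` (if
`β ≠ 0`, `x = 0`), and `(x,y,z,t) = (1, n/4, 0, 0)` if `α = β = 0` — `Q(b) = n`, a chosen non-square.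

**THEOREM** (`no_design4_mem₁/₂/₃`, every odd `p`; `GL₄` and, through
`SummandTransport.design_comap`, every `GL_m`, `m ≥ 4`, on any four coordinates:
`no_design4_mem₁/₂/₃_all`; cover form `no_design4_of_cover`).  No member of a triple
`(H₁,H₂,H₃) ≤ GL_m(𝔽_p)³` carrying a level-one identity design contains all non-square reflections
`R_b`, `b ∈ 𝔽_p⁴ ⊕ 0`, `Q(b)` a non-square; equivalently the group `⟨R_b : Q(b) non-square⟩ ⊕ 1`
they generate is never inside `H₁H₂H₃ ∪ 1` as a set of triple products (cover form).  Proof: the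
generic fix-cover form `NonsquareReflections.no_design_of_fixCover` (a determinant cover,
`GLmLevelOneCertificates.no_levelOne_design_of_detFixers_gl`) and the cover lemma.  No TPP and no
budget hypothesis is used, so the exclusions hold for every `ε`.

DATA (code/g22/reflection_group4_check.py of the cell, exact): `⟨R_b : Q(b) non-square⟩` has index
`2` in `O₄⁺(𝔽₅)` (order `14400`) and is `W(D₄)` (order `192`, index `6`) inside
`O₄⁺(𝔽₃) = W(F₄)`; it contains `−1` in both cases (compare `ScalarLaw.neg_one_mem_atMostOne`: under
the TPP `−1` lies in at most one member — here no TPP is assumed and the conclusion concerns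
designs); the fix-cover of the lemma was re-verified by enumeration for `p = 3, 5`.

COORDINATE-FREE FORMS (`emb_refl`: `emb e (R_b) = R_{(b,0)}`, the block embedding of a
reflection is the reflection of the vector extended by zero): **no member of a triple carrying a
level-one identity design contains all non-square reflections of `𝔽_p^m`** — for every odd `p`
when `m ≥ 4` (`no_design_mem₁/₂/₃_of_four_le`), and for `p ≡ 3 (mod 4)` when `m ≥ 3`
(`no_design_mem₁/₂/₃_of_three_le`, from `NonsquareReflections.no_design_mem₁/₂/₃_all`).

HONEST SCOPE.  Configuration exclusions; no `(p,m,ε)` cell is emptied.  The three-dimensional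
sign-twisted group `K_p⁻ ≅ PGL₂(𝔽_p)` for `p ≡ 1 (mod 4)` (no determinant cover; a twisted cusp
form is the expected certificate) stays open.
-/

set_option linter.dupNamespace false

noncomputable section

open scoped BigOperators Classical Matrix

namespace Summit.MatrixMultiplication.MatrixMultiplication.Theorems.SubgroupIdentityDesigns.Negative
namespace NonsquareReflections

open Summit.MatrixMultiplication.MatrixMultiplication.Theorems.LieRankDesigns.Negative (GLm Mat)
open SummandTransport (emb design_comap)
open Literature.NumberTheory.EllipticCurves.BinaryQuartic (two_ne_zero_zmod)
open Literature.NumberTheory.EllipticCurves.ModularForms (four_ne_zero_zmod)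
open DihedralUnipotent (neg_one_ne_one)

variable {p : ℕ} [hp : Fact p.Prime]

/-! Arithmetic of odd `p` (`2 ≠ 0`, `4 ≠ 0`, `−1 ≠ 1`) is reused from the tree:
`BinaryQuartic.two_ne_zero_zmod`, `ModularForms.four_ne_zero_zmod`, `DihedralUnipotent.neg_one_ne_one`. -/

/-! ## The cover lemma in dimension four -/

/-- **HYPERBOLIC COORDINATES.**  If `i² = −1` and `x, y, z, t` satisfy the linear condition
`(u₀ + i u₁) x + (u₀ − i u₁) y + (u₂ + i u₃) z + (u₂ − i u₃) t = 0` and `4(xy + zt) = n` with `n` a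
non-square, then `b = (x + y, i(x − y), z + t, i(z − t))` is orthogonal to `u` with `Q(b) = n`. -/
theorem hyperbolic_witness {i n : ZMod p} (hi : -1 = i * i) (hn : ¬ IsSquare n) (u : Fin 4 → ZMod p)
    (x y z t : ZMod p)
    (hlin : (u 0 + i * u 1) * x + (u 0 - i * u 1) * y + (u 2 + i * u 3) * z + (u 2 - i * u 3) * t = 0)
    (hq : 4 * (x * y + z * t) = n) :
    ∃ b : Fin 4 → ZMod p, b ⬝ᵥ u = 0 ∧ ¬ IsSquare (b ⬝ᵥ b) := by
  refine ⟨![x + y, i * (x - y), z + t, i * (z - t)], ?_, ?_⟩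
  · simp only [dotProduct, Fin.sum_univ_four, Matrix.cons_val_zero, Matrix.cons_val_one,
      Matrix.cons_val]
    linear_combination hlin
  · have hQ : ![x + y, i * (x - y), z + t, i * (z - t)] ⬝ᵥ ![x + y, i * (x - y), z + t, i * (z - t)]
        = n := by
      simp only [dotProduct, Fin.sum_univ_four, Matrix.cons_val_zero, Matrix.cons_val_one,
        Matrix.cons_val]
      linear_combination (-((x - y) ^ 2 + (z - t) ^ 2)) * hi + hq
    rw [hQ]
    exact hn

/-- **THE COVER LEMMA IN DIMENSION FOUR** (every odd `p`): every `u ∈ 𝔽_p⁴` is orthogonal to some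
`b` with `Q(b)` a non-square. -/
theorem exists_orth_nonsquare4 (hp2 : p ≠ 2) (u : Fin 4 → ZMod p) :
    ∃ b : Fin 4 → ZMod p, b ⬝ᵥ u = 0 ∧ ¬ IsSquare (b ⬝ᵥ b) := by
  by_cases hm1 : IsSquare (-1 : ZMod p)
  · -- `−1 = i²`: hyperbolic coordinates
    obtain ⟨i, hi⟩ := hm1
    have hF : ringChar (ZMod p) ≠ 2 := by rw [ZMod.ringChar_zmod_n]; exact hp2
    obtain ⟨n, hn⟩ := FiniteField.exists_nonsquare hF
    have h4 := four_ne_zero_zmod hp2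
    have hq0 : (4 : ZMod p) * (n / 4) = n := mul_div_cancel₀ n h4
    by_cases hα : u 0 + i * u 1 = 0
    · by_cases hβ : u 0 - i * u 1 = 0
      · exact hyperbolic_witness hi hn u 1 (n / 4) 0 0 (by rw [hα, hβ]; ring)
          (by rw [one_mul, mul_zero, add_zero]; exact hq0)
      · refine hyperbolic_witness hi hn u 0 (-((u 2 + i * u 3) + (u 2 - i * u 3) * (n / 4)) /
            (u 0 - i * u 1)) 1 (n / 4) ?_ (by rw [zero_mul, zero_add, one_mul]; exact hq0)
        rw [hα, mul_div_cancel₀ _ hβ]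
        ring
    · refine hyperbolic_witness hi hn u (-((u 2 + i * u 3) + (u 2 - i * u 3) * (n / 4)) /
          (u 0 + i * u 1)) 0 1 (n / 4) ?_ (by rw [mul_zero, zero_add, one_mul]; exact hq0)
      rw [mul_div_cancel₀ _ hα]
      ring
  · -- `−1` a non-square: three coordinates suffice
    by_cases hu : (![u 0, u 1, u 2] : Fin 3 → ZMod p) = 0
    · have h0 : u 0 = 0 := by simpa using congr_fun hu 0
      have h1 : u 1 = 0 := by simpa using congr_fun hu 1
      obtain ⟨x, y, hxy⟩ := ZMod.sq_add_sq p (-1)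
      refine ⟨![x, y, 0, 0], ?_, ?_⟩
      · simp [dotProduct, Fin.sum_univ_four, h0, h1]
      · have hQ : ![x, y, 0, 0] ⬝ᵥ ![x, y, 0, 0] = -1 := by
          simp only [dotProduct, Fin.sum_univ_four, Matrix.cons_val_zero, Matrix.cons_val_one,
            Matrix.cons_val]
          linear_combination hxy
        rw [hQ]
        exact hm1
    · obtain ⟨b, hbu, hb⟩ := exists_orth_nonsquare hm1 _ hu
      refine ⟨![b 0, b 1, b 2, 0], ?_, ?_⟩
      · have h3 : b ⬝ᵥ ![u 0, u 1, u 2] = b 0 * u 0 + b 1 * u 1 + b 2 * u 2 := by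
          simp only [dotProduct, Fin.sum_univ_three, Matrix.cons_val_zero, Matrix.cons_val_one,
            Matrix.cons_val]
        simp only [dotProduct, Fin.sum_univ_four, Matrix.cons_val_zero, Matrix.cons_val_one,
          Matrix.cons_val, zero_mul, add_zero]
        rw [← h3, hbu]
      · have hQ : ![b 0, b 1, b 2, 0] ⬝ᵥ ![b 0, b 1, b 2, 0] = b ⬝ᵥ b := by
          simp only [dotProduct, Fin.sum_univ_four, Fin.sum_univ_three, Matrix.cons_val_zero,
            Matrix.cons_val_one, Matrix.cons_val, zero_mul, add_zero]
        rw [hQ]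
        exact hb

/-! ## The exclusion in `GL₄(𝔽_p)` -/

section GL4

variable {H₁ H₂ H₃ : Subgroup (GLm p 4)}

/-- **COVER FORM in `GL₄(𝔽_p)`** (every odd `p`).  If every non-trivial element of the group
generated by the non-square reflections of `𝔽_p⁴` is a triple product `a b g ∈ H₁ H₂ H₃`, then
`(H₁, H₂, H₃)` carries no level-one identity design. -/
theorem no_design4_of_cover (hp2 : p ≠ 2)
    (hmem : ∀ k ∈ reflGroup p 4, k ≠ 1 → ∃ a ∈ H₁, ∃ b ∈ H₂, ∃ g ∈ H₃, a * b * g = k) :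
    ¬ ∃ c : Mat p 4 → ℂ, (∀ M, 1 < M.rank → c M = 0) ∧
      (∑ M, c M * ZMod.stdAddChar (Matrix.trace (M * ((1 : GLm p 4) : Mat p 4)))) = 1 ∧
      ∀ a ∈ H₁, ∀ b ∈ H₂, ∀ g ∈ H₃, a * b * g ≠ 1 →
        (∑ M, c M * ZMod.stdAddChar (Matrix.trace (M * ((a * b * g : GLm p 4) : Mat p 4)))) = 0 :=
  no_design_of_fixCover (neg_one_ne_one hp2) (fun u _ => exists_orth_nonsquare4 hp2 u) hmem

/-- **No member contains all non-square reflections of `𝔽_p⁴`** (every odd `p`): member `1`. -/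
theorem no_design4_mem₁ (hp2 : p ≠ 2)
    (h₁ : ∀ b : Fin 4 → ZMod p, ¬ IsSquare (b ⬝ᵥ b) → refl b ∈ H₁) :
    ¬ ∃ c : Mat p 4 → ℂ, (∀ M, 1 < M.rank → c M = 0) ∧
      (∑ M, c M * ZMod.stdAddChar (Matrix.trace (M * ((1 : GLm p 4) : Mat p 4)))) = 1 ∧
      ∀ a ∈ H₁, ∀ b ∈ H₂, ∀ g ∈ H₃, a * b * g ≠ 1 →
        (∑ M, c M * ZMod.stdAddChar (Matrix.trace (M * ((a * b * g : GLm p 4) : Mat p 4)))) = 0 :=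
  no_design4_of_cover hp2 (triple_of_le₁ (reflGroup_le h₁))

/-- Member `2`. -/
theorem no_design4_mem₂ (hp2 : p ≠ 2)
    (h₂ : ∀ b : Fin 4 → ZMod p, ¬ IsSquare (b ⬝ᵥ b) → refl b ∈ H₂) :
    ¬ ∃ c : Mat p 4 → ℂ, (∀ M, 1 < M.rank → c M = 0) ∧
      (∑ M, c M * ZMod.stdAddChar (Matrix.trace (M * ((1 : GLm p 4) : Mat p 4)))) = 1 ∧
      ∀ a ∈ H₁, ∀ b ∈ H₂, ∀ g ∈ H₃, a * b * g ≠ 1 →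
        (∑ M, c M * ZMod.stdAddChar (Matrix.trace (M * ((a * b * g : GLm p 4) : Mat p 4)))) = 0 :=
  no_design4_of_cover hp2 (triple_of_le₂ (reflGroup_le h₂))

/-- Member `3`. -/
theorem no_design4_mem₃ (hp2 : p ≠ 2)
    (h₃ : ∀ b : Fin 4 → ZMod p, ¬ IsSquare (b ⬝ᵥ b) → refl b ∈ H₃) :
    ¬ ∃ c : Mat p 4 → ℂ, (∀ M, 1 < M.rank → c M = 0) ∧
      (∑ M, c M * ZMod.stdAddChar (Matrix.trace (M * ((1 : GLm p 4) : Mat p 4)))) = 1 ∧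
      ∀ a ∈ H₁, ∀ b ∈ H₂, ∀ g ∈ H₃, a * b * g ≠ 1 →
        (∑ M, c M * ZMod.stdAddChar (Matrix.trace (M * ((a * b * g : GLm p 4) : Mat p 4)))) = 0 :=
  no_design4_of_cover hp2 (triple_of_le₃ (reflGroup_le h₃))

end GL4

/-! ## Every dimension `m ≥ 4`: the reflections of four coordinates -/

section GLm

variable {l n : ℕ} (e : Fin 4 ⊕ Fin l ≃ Fin n) {H₁ H₂ H₃ : Subgroup (GLm p n)}

/-- **BLOCK COVER FORM in `GL_n(𝔽_p)`** (every odd `p`, any four coordinates). -/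
theorem no_design4_of_blockCover (hp2 : p ≠ 2)
    (hmem : ∀ k ∈ reflGroup p 4, k ≠ 1 → ∃ a b g : GLm p 4, emb e a ∈ H₁ ∧ emb e b ∈ H₂ ∧
      emb e g ∈ H₃ ∧ a * b * g = k) :
    ¬ ∃ c : Mat p n → ℂ, (∀ M, 1 < M.rank → c M = 0) ∧
      (∑ M, c M * ZMod.stdAddChar (Matrix.trace (M * ((1 : GLm p n) : Mat p n)))) = 1 ∧
      ∀ a ∈ H₁, ∀ b ∈ H₂, ∀ g ∈ H₃, a * b * g ≠ 1 →
        (∑ M, c M * ZMod.stdAddChar (Matrix.trace (M * ((a * b * g : GLm p n) : Mat p n)))) = 0 :=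
  fun hdes => no_design4_of_cover (H₁ := H₁.comap (emb e)) (H₂ := H₂.comap (emb e))
    (H₃ := H₃.comap (emb e)) hp2
    (fun k hk h1 => by
      obtain ⟨a, b, g, ha, hb, hg, h⟩ := hmem k hk h1
      exact ⟨a, Subgroup.mem_comap.mpr ha, b, Subgroup.mem_comap.mpr hb, g,
        Subgroup.mem_comap.mpr hg, h⟩)
    (design_comap e 1 hdes)

/-- **No member contains the non-square reflections of four coordinates** (every odd `p`, any
`n ≥ 4`): member `1`. -/
theorem no_design4_mem₁_all (hp2 : p ≠ 2)
    (h₁ : ∀ b : Fin 4 → ZMod p, ¬ IsSquare (b ⬝ᵥ b) → emb e (refl b) ∈ H₁) :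
    ¬ ∃ c : Mat p n → ℂ, (∀ M, 1 < M.rank → c M = 0) ∧
      (∑ M, c M * ZMod.stdAddChar (Matrix.trace (M * ((1 : GLm p n) : Mat p n)))) = 1 ∧
      ∀ a ∈ H₁, ∀ b ∈ H₂, ∀ g ∈ H₃, a * b * g ≠ 1 →
        (∑ M, c M * ZMod.stdAddChar (Matrix.trace (M * ((a * b * g : GLm p n) : Mat p n)))) = 0 :=
  fun hdes => no_design4_mem₁ (H₁ := H₁.comap (emb e)) (H₂ := H₂.comap (emb e))
    (H₃ := H₃.comap (emb e)) hp2 (fun b hb => Subgroup.mem_comap.mpr (h₁ b hb))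
    (design_comap e 1 hdes)

/-- Member `2`, any `n ≥ 4`. -/
theorem no_design4_mem₂_all (hp2 : p ≠ 2)
    (h₂ : ∀ b : Fin 4 → ZMod p, ¬ IsSquare (b ⬝ᵥ b) → emb e (refl b) ∈ H₂) :
    ¬ ∃ c : Mat p n → ℂ, (∀ M, 1 < M.rank → c M = 0) ∧
      (∑ M, c M * ZMod.stdAddChar (Matrix.trace (M * ((1 : GLm p n) : Mat p n)))) = 1 ∧
      ∀ a ∈ H₁, ∀ b ∈ H₂, ∀ g ∈ H₃, a * b * g ≠ 1 →
        (∑ M, c M * ZMod.stdAddChar (Matrix.trace (M * ((a * b * g : GLm p n) : Mat p n)))) = 0 :=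
  fun hdes => no_design4_mem₂ (H₁ := H₁.comap (emb e)) (H₂ := H₂.comap (emb e))
    (H₃ := H₃.comap (emb e)) hp2 (fun b hb => Subgroup.mem_comap.mpr (h₂ b hb))
    (design_comap e 1 hdes)

/-- Member `3`, any `n ≥ 4`. -/
theorem no_design4_mem₃_all (hp2 : p ≠ 2)
    (h₃ : ∀ b : Fin 4 → ZMod p, ¬ IsSquare (b ⬝ᵥ b) → emb e (refl b) ∈ H₃) :
    ¬ ∃ c : Mat p n → ℂ, (∀ M, 1 < M.rank → c M = 0) ∧
      (∑ M, c M * ZMod.stdAddChar (Matrix.trace (M * ((1 : GLm p n) : Mat p n)))) = 1 ∧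
      ∀ a ∈ H₁, ∀ b ∈ H₂, ∀ g ∈ H₃, a * b * g ≠ 1 →
        (∑ M, c M * ZMod.stdAddChar (Matrix.trace (M * ((a * b * g : GLm p n) : Mat p n)))) = 0 :=
  fun hdes => no_design4_mem₃ (H₁ := H₁.comap (emb e)) (H₂ := H₂.comap (emb e))
    (H₃ := H₃.comap (emb e)) hp2 (fun b hb => Subgroup.mem_comap.mpr (h₃ b hb))
    (design_comap e 1 hdes)

end GLm

/-! ## Coordinate-free forms: all non-square reflections of `𝔽_p^m` -/

section CoordinateFree

variable {n l m : ℕ} (e : Fin n ⊕ Fin l ≃ Fin m)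

/-- Extension by zero of a vector of `R^n` to `R^m` along the coordinates `e`. -/
def extVec {R : Type*} [Zero R] (b : Fin n → R) : Fin m → R := fun j => Sum.elim b 0 (e.symm j)

/-- Entries of `extVec` in the `e`-coordinates. -/
@[simp] theorem extVec_apply {R : Type*} [Zero R] (b : Fin n → R) (x : Fin n ⊕ Fin l) :
    extVec e b (e x) = Sum.elim b 0 x := by
  simp [extVec]

/-- Extension by zero preserves dot products. -/
theorem extVec_dotProduct {R : Type*} [NonUnitalNonAssocSemiring R] (b c : Fin n → R) :
    extVec e b ⬝ᵥ extVec e c = b ⬝ᵥ c := by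
  unfold dotProduct
  rw [← e.sum_comp]
  simp [Fintype.sum_sum_type]

/-- **The block embedding of a reflection is the reflection of the extended vector**:
`emb e (R_b) = R_{(b,0)}`. -/
theorem emb_refl (b : Fin n → ZMod p) : emb e (refl b) = refl (extVec e b) := by
  apply Units.ext
  rw [SummandTransport.coe_emb, coe_refl, coe_refl]
  ext i j
  obtain ⟨x, rfl⟩ := e.surjective i
  obtain ⟨y, rfl⟩ := e.surjective j
  rw [SummandTransport.embMat_apply]
  unfold reflMat
  rw [extVec_dotProduct]
  rcases x with x | x <;> rcases y with y | y <;>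
    simp [Matrix.vecMulVec_apply, Matrix.one_apply]

/-- **NO MEMBER CONTAINS ALL NON-SQUARE REFLECTIONS OF `𝔽_p^m`, `m ≥ 4`, `p` odd**: member `1`. -/
theorem no_design_mem₁_of_four_le (hp2 : p ≠ 2) (hm : 4 ≤ m) {H₁ H₂ H₃ : Subgroup (GLm p m)}
    (h₁ : ∀ b : Fin m → ZMod p, ¬ IsSquare (b ⬝ᵥ b) → refl b ∈ H₁) :
    ¬ ∃ c : Mat p m → ℂ, (∀ M, 1 < M.rank → c M = 0) ∧
      (∑ M, c M * ZMod.stdAddChar (Matrix.trace (M * ((1 : GLm p m) : Mat p m)))) = 1 ∧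
      ∀ a ∈ H₁, ∀ b ∈ H₂, ∀ g ∈ H₃, a * b * g ≠ 1 →
        (∑ M, c M * ZMod.stdAddChar (Matrix.trace (M * ((a * b * g : GLm p m) : Mat p m)))) = 0 := by
  obtain ⟨l, rfl⟩ := Nat.exists_eq_add_of_le hm
  exact no_design4_mem₁_all finSumFinEquiv hp2 fun b hb => by
    rw [emb_refl]
    exact h₁ _ (by rwa [extVec_dotProduct])

/-- Member `2`, `m ≥ 4`, `p` odd. -/
theorem no_design_mem₂_of_four_le (hp2 : p ≠ 2) (hm : 4 ≤ m) {H₁ H₂ H₃ : Subgroup (GLm p m)}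
    (h₂ : ∀ b : Fin m → ZMod p, ¬ IsSquare (b ⬝ᵥ b) → refl b ∈ H₂) :
    ¬ ∃ c : Mat p m → ℂ, (∀ M, 1 < M.rank → c M = 0) ∧
      (∑ M, c M * ZMod.stdAddChar (Matrix.trace (M * ((1 : GLm p m) : Mat p m)))) = 1 ∧
      ∀ a ∈ H₁, ∀ b ∈ H₂, ∀ g ∈ H₃, a * b * g ≠ 1 →
        (∑ M, c M * ZMod.stdAddChar (Matrix.trace (M * ((a * b * g : GLm p m) : Mat p m)))) = 0 := by
  obtain ⟨l, rfl⟩ := Nat.exists_eq_add_of_le hm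
  exact no_design4_mem₂_all finSumFinEquiv hp2 fun b hb => by
    rw [emb_refl]
    exact h₂ _ (by rwa [extVec_dotProduct])

/-- Member `3`, `m ≥ 4`, `p` odd. -/
theorem no_design_mem₃_of_four_le (hp2 : p ≠ 2) (hm : 4 ≤ m) {H₁ H₂ H₃ : Subgroup (GLm p m)}
    (h₃ : ∀ b : Fin m → ZMod p, ¬ IsSquare (b ⬝ᵥ b) → refl b ∈ H₃) :
    ¬ ∃ c : Mat p m → ℂ, (∀ M, 1 < M.rank → c M = 0) ∧
      (∑ M, c M * ZMod.stdAddChar (Matrix.trace (M * ((1 : GLm p m) : Mat p m)))) = 1 ∧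
      ∀ a ∈ H₁, ∀ b ∈ H₂, ∀ g ∈ H₃, a * b * g ≠ 1 →
        (∑ M, c M * ZMod.stdAddChar (Matrix.trace (M * ((a * b * g : GLm p m) : Mat p m)))) = 0 := by
  obtain ⟨l, rfl⟩ := Nat.exists_eq_add_of_le hm
  exact no_design4_mem₃_all finSumFinEquiv hp2 fun b hb => by
    rw [emb_refl]
    exact h₃ _ (by rwa [extVec_dotProduct])

/-- **NO MEMBER CONTAINS ALL NON-SQUARE REFLECTIONS OF `𝔽_p^m`, `m ≥ 3`, `p ≡ 3 (mod 4)`**: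
member `1`. -/
theorem no_design_mem₁_of_three_le (hm1 : ¬ IsSquare (-1 : ZMod p)) (hm : 3 ≤ m)
    {H₁ H₂ H₃ : Subgroup (GLm p m)}
    (h₁ : ∀ b : Fin m → ZMod p, ¬ IsSquare (b ⬝ᵥ b) → refl b ∈ H₁) :
    ¬ ∃ c : Mat p m → ℂ, (∀ M, 1 < M.rank → c M = 0) ∧
      (∑ M, c M * ZMod.stdAddChar (Matrix.trace (M * ((1 : GLm p m) : Mat p m)))) = 1 ∧
      ∀ a ∈ H₁, ∀ b ∈ H₂, ∀ g ∈ H₃, a * b * g ≠ 1 →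
        (∑ M, c M * ZMod.stdAddChar (Matrix.trace (M * ((a * b * g : GLm p m) : Mat p m)))) = 0 := by
  obtain ⟨l, rfl⟩ := Nat.exists_eq_add_of_le hm
  exact no_design_mem₁_all finSumFinEquiv hm1 fun b hb => by
    rw [emb_refl]
    exact h₁ _ (by rwa [extVec_dotProduct])

/-- Member `2`, `m ≥ 3`, `p ≡ 3 (mod 4)`. -/
theorem no_design_mem₂_of_three_le (hm1 : ¬ IsSquare (-1 : ZMod p)) (hm : 3 ≤ m)
    {H₁ H₂ H₃ : Subgroup (GLm p m)}
    (h₂ : ∀ b : Fin m → ZMod p, ¬ IsSquare (b ⬝ᵥ b) → refl b ∈ H₂) :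
    ¬ ∃ c : Mat p m → ℂ, (∀ M, 1 < M.rank → c M = 0) ∧
      (∑ M, c M * ZMod.stdAddChar (Matrix.trace (M * ((1 : GLm p m) : Mat p m)))) = 1 ∧
      ∀ a ∈ H₁, ∀ b ∈ H₂, ∀ g ∈ H₃, a * b * g ≠ 1 →
        (∑ M, c M * ZMod.stdAddChar (Matrix.trace (M * ((a * b * g : GLm p m) : Mat p m)))) = 0 := by
  obtain ⟨l, rfl⟩ := Nat.exists_eq_add_of_le hm
  exact no_design_mem₂_all finSumFinEquiv hm1 fun b hb => by
    rw [emb_refl]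
    exact h₂ _ (by rwa [extVec_dotProduct])

/-- Member `3`, `m ≥ 3`, `p ≡ 3 (mod 4)`. -/
theorem no_design_mem₃_of_three_le (hm1 : ¬ IsSquare (-1 : ZMod p)) (hm : 3 ≤ m)
    {H₁ H₂ H₃ : Subgroup (GLm p m)}
    (h₃ : ∀ b : Fin m → ZMod p, ¬ IsSquare (b ⬝ᵥ b) → refl b ∈ H₃) :
    ¬ ∃ c : Mat p m → ℂ, (∀ M, 1 < M.rank → c M = 0) ∧
      (∑ M, c M * ZMod.stdAddChar (Matrix.trace (M * ((1 : GLm p m) : Mat p m)))) = 1 ∧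
      ∀ a ∈ H₁, ∀ b ∈ H₂, ∀ g ∈ H₃, a * b * g ≠ 1 →
        (∑ M, c M * ZMod.stdAddChar (Matrix.trace (M * ((a * b * g : GLm p m) : Mat p m)))) = 0 := by
  obtain ⟨l, rfl⟩ := Nat.exists_eq_add_of_le hm
  exact no_design_mem₃_all finSumFinEquiv hm1 fun b hb => by
    rw [emb_refl]
    exact h₃ _ (by rwa [extVec_dotProduct])

end CoordinateFree

end NonsquareReflections
end Summit.MatrixMultiplication.MatrixMultiplication.Theorems.SubgroupIdentityDesigns.Negative

end
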